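import Summits.ValiantsHypothesis.ValiantsHypothesis.Theorems.BarrierLeverSuccinctHittingSetsForVPOccurFormulas
import Literature.Computability.AlgebraicComplexity.FSV18Thm9Holds

/-!
# Crux `BarrierLever.SuccinctHittingSetsForVP` (stmt-ValiantsHypothesis-14610) — the occur-formula
# slice made UNCONDITIONAL: FSV Thm. 9 bullet 6 is now a theorem of the tree

`BarrierLeverSuccinctHittingSetsForVPOccurFormulas.lean` proved `isSuccinctHittingSet_occur` and
`not_isNaturalProof_occur` under the hypothesis `(h : FSV2018_thm9_occur)`. That named fact is now a
THEOREM of the tree: `FSV2018_thm9_occur_holds` (`FSV18Thm9Holds.lean`; val-lit N1 chain: [ASSS16]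
bounded-top-fan-in route to FSV Thm. 48, `FSV2018_thm48_topFanIn_holds`, and the bypass
`FSV2018_thm9_occur_of_thm48_topFanIn`), so both statements hold outright:

* `isSuccinctHittingSet_occur'` — for all `D k a` there are `b n₀` with: for `n ≥ n₀`, `s ≤ 2^{n^a}`,
  the multilinear members of `SmallCircuits ℂ n b` hit every nonzero distinguisher computed by a
  size-`≤ s` depth-`≤ D` occur-`≤ k` formula in the `2^n` multilinear coefficient variables;
* `not_isNaturalProof_occur'` — no such formula is a natural proof against
  `SmallCircuits ℂ n b' ∩ multilinearSlice ℂ n`, `b' ≥ b`.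

HONEST FRAMING. Multilinear-frame slice (`M = multilinearMonomials n`) toward the rung; the rung
`Theses.BarrierLever.SuccinctHittingSetsForVP` (frame `degLEMonomials`, all `poly(N)`-size
distinguishers) is NOT reached and stays OPEN; `VP ≠ VNP` is NOT proved. No `sorry`, no named-fact
hypotheses, no definitions.

References: [ForbesShpilkaVolk2018] Thm. 9 bullet 6, Cor. 49; [AgrawalSahaSaptharishiSaxena2016]
§4 (bounded top fan-in).
-/

-- layout Summits/ValiantsHypothesis/ValiantsHypothesis forces the duplicated namespace component
set_option linter.dupNamespace false

noncomputable section

namespace Summit.ValiantsHypothesis.ValiantsHypothesis.Theorems.BarrierLever.SuccinctHittingSetsForVP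

open Literature.Barriers.ValiantsHypothesis Literature.Computability.AlgebraicComplexity MvPolynomial

/-- **Occur-`k` depth-`D` formula distinguishers are hit — multilinear frame, UNCONDITIONAL**:
`isSuccinctHittingSet_occur` with its hypothesis discharged by `FSV2018_thm9_occur_holds`. The
rung stays open.
[cite: ForbesShpilkaVolk2018, Thm. 9 bullet 6 and Cor. 49 (= ToC Thm. 1.10, Cor. 5.25)] -/
theorem isSuccinctHittingSet_occur' (D k a : ℕ) :
    ∃ b n₀ : ℕ, ∀ n, n₀ ≤ n → ∀ s, s ≤ 2 ^ (n ^ a) →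
      IsSuccinctHittingSet (multilinearMonomials n) (SmallCircuits ℂ n b ∩ multilinearSlice ℂ n)
        (occurClass ℂ (multilinearMonomials n) D k s) :=
  isSuccinctHittingSet_occur FSV2018_thm9_occur_holds D k a

/-- **No occur-`k` depth-`D` formula natural proofs against the multilinear members of `VP` —
UNCONDITIONAL**: `not_isNaturalProof_occur` with its hypothesis discharged. Multilinear-frame slice;
the rung stays open. [cite: ForbesShpilkaVolk2018, Def. 1, Thm. 4 and Thm. 9 bullet 6] -/
theorem not_isNaturalProof_occur' (D k a : ℕ) :
    ∃ b n₀ : ℕ, ∀ n, n₀ ≤ n → ∀ b', b ≤ b' → ∀ s, s ≤ 2 ^ (n ^ a) →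
      ∀ (𝒟 : Set (MvPolynomial (multilinearMonomials n) ℂ))
        (Δ : MvPolynomial (multilinearMonomials n) ℂ),
        Δ ∈ occurClass ℂ (multilinearMonomials n) D k s →
          ¬ IsNaturalProof (multilinearMonomials n) (SmallCircuits ℂ n b' ∩ multilinearSlice ℂ n) 𝒟 Δ :=
  not_isNaturalProof_occur FSV2018_thm9_occur_holds D k a

end Summit.ValiantsHypothesis.ValiantsHypothesis.Theorems.BarrierLever.SuccinctHittingSetsForVP

end
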